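import Literature.AlgebraicGeometry.Modules.VanishingLocusFiniteLocallyFree
import Literature.AlgebraicGeometry.Modules.PullbackQuasicoherent
import Literature.AlgebraicGeometry.Morphisms.ContainmentLocusClosed
import HarnessLib

/-!
# The vanishing locus of a morphism into a vector bundle commutes with base change: `V(u) ×_X T = V(g^* u)`

Topic `Literature/AlgebraicGeometry/Modules`, namespace `Literature.AlgebraicGeometry.Modules`.  THEOREMS ONLY (no definition,
no instance, no notation, no named fact, no `sorry`).  Cell `hodgecm-mathlib` (D-0151), F-DAG leaf F-5 (5d) (director s232;
B-plan1 (g17) 09:09:40Z), first brick of the (II′) MONO wrapper «`Z = V(u_{K_Z(d)})`» (author B-p20 (g12)); second consumer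
(III-Gr) «`Z_{g^*𝒦} = Z_𝒦 ×_{Gr} T`» (B-p03 (g18); B-p21 (g17) census `CENSUS-F5d-HilbToGrassmannianRelative` §3 (D3)(b)).
Count-neutral Mathlib-side capital: HC_CM is proved only modulo the 7 printed citations until rung 0 closes — nothing here is
about HC.

For a morphism `u : 𝓔 ⟶ 𝓥` of `𝒪_X`-modules with `𝓔` affine-localizing (quasi-coherent) and `𝓥` finite locally free, ★
`Modules/VanishingLocusOfHom` defines the vanishing locus `V(u) ↪ X` (ideal sheaf `vanishingIdeal u`, [Fulton1998] B.3.4) and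
proves its universal property ★ `vanishingIdeal_le_ker_iff`: `g : T ⟶ X` factors through `V(u)` iff `g^* u = 0`.  Since
`(h ≫ g)^* u = 0 ↔ h^*(g^* u) = 0` (§1), the closed subschemes `V(u) ×_X T` and `V(g^* u)` of `T` cut out the SAME subfunctor,
hence coincide ([GortzWedhorn2020] Prop. 4.20 «closed subschemes and base change: `V(𝔞) ×_{Spec A} X = V(𝔞 𝒪_X)`»; a closed
subscheme is determined by its functor of points, ★ `Morphisms.idealSheafData_eq_of_forall_le_ker_iff`):

* §1 `pullback_comp_map_eq_zero_iff` — `(h ≫ g)^* u = 0 ↔ h^*(g^* u) = 0` (Mathlib `Scheme.Modules.pullbackComp`);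
* §2 **`comap_vanishingIdeal`** — `(vanishingIdeal u).comap g = vanishingIdeal (g^* u)` in Mathlib's `IdealSheafData.comap`
  (= the ideal sheaf of `T ×_X V(u) ↪ T`), and the factorisation criterion through `V(u)` for `b ≫ g`;
* §3 **`isPullback_subschemeι_vanishingIdeal`** — the square `V(g^* u) ⟶ V(u)` over `g : T ⟶ X` is CARTESIAN (Mathlib
  `isPullback_of_isClosedImmersion`).

## References
* [GortzWedhorn2020] U. Görtz, T. Wedhorn, *Algebraic Geometry I*, 2nd ed. (2020), Prop. 4.20 (closed subschemes and base change),
  §(4.13) (fibre products and base change of subschemes).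
* [Fulton1998] W. Fulton, *Intersection Theory*, 2nd ed. (1998), App. B.3.4 (PDF p. 410) (zero scheme of a section / of a map of bundles).
* [Hartshorne1977] R. Hartshorne, *Algebraic Geometry* (1977), II Prop. 5.9 (PDF p. 146), II §5 p. 110.
-/

noncomputable section

-- `TopCat.Presheaf`/`Scheme.Modules` are not reducible (as in Mathlib's `AlgebraicGeometry/Modules`).
set_option backward.isDefEq.respectTransparency false

universe u

open CategoryTheory CategoryTheory.Limits AlgebraicGeometry TopologicalSpace Opposite

namespace Literature.AlgebraicGeometry.Modules

open Literature.AlgebraicGeometry.Motives Literature.AlgebraicGeometry.Morphisms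

variable {X T : Scheme.{u}} (g : T ⟶ X) {E V : X.Modules} (u : E ⟶ V)

/-! ## §1 `(h ≫ g)^* u = 0 ↔ h^*(g^* u) = 0` -/

/-- **`(h ≫ g)^* u = 0 ↔ h^*(g^* u) = 0`** — the two differ by the natural isomorphism `h^* ∘ g^* ≅ (h ≫ g)^*` (Mathlib
`Scheme.Modules.pullbackComp`; compare ★ `pullback_comp_map_eq_zero`: `g^* u = 0 ⇒ (h ≫ g)^* u = 0`). [cite: Hartshorne1977, II §5 p. 110] -/
theorem pullback_comp_map_eq_zero_iff {T' : Scheme.{u}} (h : T' ⟶ T) :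
    (Scheme.Modules.pullback (h ≫ g)).map u = 0 ↔
      (Scheme.Modules.pullback h).map ((Scheme.Modules.pullback g).map u) = 0 := by
  have nat := (Scheme.Modules.pullbackComp h g).hom.naturality u
  rw [Functor.comp_map] at nat
  refine ⟨fun hu => ?_, fun hu => ?_⟩
  · rw [hu, comp_zero] at nat
    rw [← cancel_mono ((Scheme.Modules.pullbackComp h g).hom.app V), zero_comp, nat]
  · rw [hu, zero_comp] at nat
    rw [← cancel_epi ((Scheme.Modules.pullbackComp h g).hom.app E), comp_zero, ← nat]

/-! ## §2 `V(u) ×_X T = V(g^* u)` as ideal sheaves -/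

/-- **`b : T' ⟶ T` followed by `g` factors through `V(u)` iff `b` factors through `V(g^* u)`**, ideal form:
`vanishingIdeal u ≤ ker (b ≫ g)^♯ ↔ vanishingIdeal (g^* u) ≤ ker b^♯` (★ `vanishingIdeal_le_ker_iff` twice and §1; the side
hypotheses of the pulled-back data are ★ `IsAffineLocalizing.pullback`, ★ `IsFiniteLocallyFree.pullback`).
[cite: GortzWedhorn2020, Prop. 4.20] [cite: Fulton1998, B.3.4 (PDF p. 410)] -/
theorem vanishingIdeal_le_ker_comp_iff (hE : IsAffineLocalizing E) (hV : IsFiniteLocallyFree V) {T' : Scheme.{u}}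
    (b : T' ⟶ T) :
    vanishingIdeal u ≤ (b ≫ g).ker ↔ vanishingIdeal ((Scheme.Modules.pullback g).map u) ≤ b.ker := by
  rw [vanishingIdeal_le_ker_iff u (b ≫ g) (frameSystemOfIsFiniteLocallyFree hV) hE
      (isAffineLocalizing_dual_of_isFiniteLocallyFree hV),
    vanishingIdeal_le_ker_iff ((Scheme.Modules.pullback g).map u) b (frameSystemOfIsFiniteLocallyFree (hV.pullback g))
      (hE.pullback g) (isAffineLocalizing_dual_of_isFiniteLocallyFree (hV.pullback g)),
    pullback_comp_map_eq_zero_iff]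

/-- **THE VANISHING LOCUS COMMUTES WITH BASE CHANGE**, ideal-sheaf form: for `u : 𝓔 ⟶ 𝓥` (`𝓔` affine-localizing, `𝓥` finite
locally free) on `X` and any `g : T ⟶ X`, the pull-back ideal sheaf of `V(u)` (Mathlib `IdealSheafData.comap`, the ideal of
`T ×_X V(u) ↪ T`) IS the vanishing ideal of `g^* u` — both cut out «`b ≫ g` kills `u`» ([GortzWedhorn2020] Prop. 4.20; a closed
subscheme is determined by its functor of points, ★ `idealSheafData_eq_of_forall_le_ker_iff`; Mathlib `le_map_iff_comap_le`,
`map_ker`). [cite: GortzWedhorn2020, Prop. 4.20] [cite: Hartshorne1977, II Prop. 5.9 (PDF p. 146)] -/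
theorem comap_vanishingIdeal (hE : IsAffineLocalizing E) (hV : IsFiniteLocallyFree V) :
    (vanishingIdeal u).comap g = vanishingIdeal ((Scheme.Modules.pullback g).map u) := by
  apply idealSheafData_eq_of_forall_le_ker_iff
  intro T' b
  rw [← Scheme.IdealSheafData.le_map_iff_comap_le, Scheme.IdealSheafData.map_ker]
  exact vanishingIdeal_le_ker_comp_iff g u hE hV b

/-- The quasi-coherent spelling of `comap_vanishingIdeal` (`𝓔` quasi-coherent in Mathlib's sense).
[cite: GortzWedhorn2020, Prop. 4.20] -/
theorem comap_vanishingIdeal' [E.IsQuasicoherent] (hV : IsFiniteLocallyFree V) :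
    (vanishingIdeal u).comap g = vanishingIdeal ((Scheme.Modules.pullback g).map u) :=
  comap_vanishingIdeal g u (IsAffineLocalizing.of_isQuasicoherent E) hV

/-! ## §3 The cartesian square `V(g^* u) ⟶ V(u)` over `g` -/

/-- `vanishingIdeal u ≤ (vanishingIdeal (g^* u)).map g` — the inequality Mathlib's `subschemeMap` wants (`le_map_iff_comap_le`
and §2). [cite: GortzWedhorn2020, Prop. 4.20] -/
theorem vanishingIdeal_le_map_vanishingIdeal_pullback (hE : IsAffineLocalizing E) (hV : IsFiniteLocallyFree V) :
    vanishingIdeal u ≤ (vanishingIdeal ((Scheme.Modules.pullback g).map u)).map g := by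
  rw [Scheme.IdealSheafData.le_map_iff_comap_le, comap_vanishingIdeal g u hE hV]

/-- **`V(g^* u) = V(u) ×_X T`**: the square formed by the two closed immersions `V(g^* u) ↪ T`, `V(u) ↪ X`, the map `g` and the
induced map `V(g^* u) ⟶ V(u)` (Mathlib `IdealSheafData.subschemeMap`) is cartesian (Mathlib `isPullback_of_isClosedImmersion` with
§2). [cite: GortzWedhorn2020, Prop. 4.20] [cite: Hartshorne1977, II Prop. 5.9 (PDF p. 146)] -/
theorem isPullback_subschemeι_vanishingIdeal (hE : IsAffineLocalizing E) (hV : IsFiniteLocallyFree V) :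
    IsPullback (vanishingIdeal ((Scheme.Modules.pullback g).map u)).subschemeι
      (Scheme.IdealSheafData.subschemeMap _ _ g (vanishingIdeal_le_map_vanishingIdeal_pullback g u hE hV))
      g (vanishingIdeal u).subschemeι :=
  isPullback_of_isClosedImmersion _ _ _ _ (Scheme.IdealSheafData.subschemeMap_subschemeι _ _ _ _).symm
    (by rw [Scheme.IdealSheafData.ker_subschemeι, Scheme.IdealSheafData.ker_subschemeι, comap_vanishingIdeal g u hE hV])

/-- **Any base change of `V(u) ↪ X` along `g` is `V(g^* u) ↪ T`**: for a cartesian square `ZT ⟶ V(u)`, `iT : ZT ⟶ T` over `g`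
(e.g. Mathlib's chosen `pullback`), the kernel of `iT` is `vanishingIdeal (g^* u)` (so `ZT ≅ V(g^* u)` over `T`).
[cite: GortzWedhorn2020, Prop. 4.20] -/
theorem ker_eq_vanishingIdeal_pullback_of_isPullback (hE : IsAffineLocalizing E) (hV : IsFiniteLocallyFree V)
    {ZT : Scheme.{u}} {iT : ZT ⟶ T} {q : ZT ⟶ (vanishingIdeal u).subscheme}
    (H : IsPullback iT q g (vanishingIdeal u).subschemeι) :
    iT.ker = vanishingIdeal ((Scheme.Modules.pullback g).map u) := by
  rw [← comap_vanishingIdeal g u hE hV, Scheme.IdealSheafData.comap,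
    ← Scheme.Hom.ker_comp_of_isIso (H.isoPullback.hom) (pullback.fst g (vanishingIdeal u).subschemeι), IsPullback.isoPullback_hom_fst]

end Literature.AlgebraicGeometry.Modules

end
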